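import Mathlib
import Summits.Ventures.PercRepro2.TypedPendantA3AtB
import Summits.Ventures.PercRepro2.PendantA3BHCov
import Summits.Ventures.PercRepro2.PendantBSideBound

/-!
# The sign of the typed `b`-row: `N₁ ≥ N₀` and `N₂ ≥ N₃` at a pendant `a₃` at `b` modulo two-copy
cross statements (blind cell PercRepro2, mine-2 g55, 2026-08-30; `conjectures/MINE-2.md` M2-121)

`TypedPendantA3AtB.lean` (g54) gives the typed row `(N₀, 3N₀ − X, 2N₀ + N₃ − X, N₃)` of a pendant
`a₃` at `b`.  Its sign — row 2′TRI there — is `X ≤ 2N₀`, which is night-3's (PM)/(T23) at the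
leaf edge (`N₁ − N₀ = N₂ − N₃ = 2N₀ − X`).  Here `2N₀ − X` is written as a typed count of four
spectator-weighted two-copy CROSS kernels: with the isolated-`a₃` kernel `K_in`
(`K3_eq_inactive_of_closed`), the six-permutation sum of `2·K_in − X` equals, pointwise modulo the
realisation relation `1_Q·1_{b∈C₁}·1_{b∈C₂} = 0` (`iQ_mul_iL_mul_iH`), the six-permutation sum of

  `1_Q(x)·(n_b(x) + 2·1_{b∈C₁}(x))·C_{o,b}(y,w) + 1_Q(x)·C^{¬b}_{o,b}(y,w) + (the mirror at `a₂`)`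

(`brow_sym_identity`, `linear_combination` with multipliers computed symbolically), where
`C_{o,b}` is p1's cross kernel `1_Q 1_Q (1_{o∈C₁}(y) − 1_{o∈C₁}(w))(1_{b∈C₂}(w) − 1_{b∈C₂}(y))` and
`C^{¬b}_{o,b}` the same kernel on the avoidance `R = Q ∩ {a₁ ↮ b}` — the 2-colouring form of BHK 1.4
with the avoided set `{a₂, b}` (the weighted identity is the two-term certificate of M2-118 add. 1).
Hence **`two_N0_sub_X_nonneg`**: `X ≤ 2N₀` under `CrossCount a₁ a₂ o b`, `CrossCount a₂ a₁ o b`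
(p1's standing two-copy statements) and the two avoidance statements (`hca`, `hca'`: the pinned
count of `C^{¬b}` on every minor is `≥ 0` — a CANDIDATE of the same standing, census 0 negatives),
and **`typedCount_pendant_a3_at_b_ge`**: `N₀ ≤ N₁` and `N₃ ≤ N₂`, so
**`typedCount_nonneg_pendant_a3_at_b`**: row 2′TRI at a pendant `a₃` at `b` reduces to row 2′TRI on
the instance with the leaf removed and on the instance with `b = a₃` merged, modulo the four
two-copy cross statements.  Own work; standard axioms.
-/

namespace Summit.Ventures.PercRepro2

open UnionCluster

namespace CovForm

namespace TypedRed

/-! ## The polynomial identity -/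

section Poly

variable {R : Type*} [Field R]

/-- **The symmetrised kernel identity of the `b`-row sign** (a polynomial identity modulo the
realisation relation `q·lb·hb = 0` in each copy): the six-permutation sum of `2·K_in − X` equals the
six-permutation sum of the four spectator-weighted cross kernels. -/
lemma brow_sym_identity (qx lox hox lbx hbx qy loy hoy lby hby qw low how lbw hbw : R)
    (hx : qx * (lbx * hbx) = 0) (hy : qy * (lby * hby) = 0) (hw : qw * (lbw * hbw) = 0) :
    (2 * (qx * (qy * (qw * ((low - how) * (lbw - hbw)))) - qx * ((qy * (lby - hby)) * (qw * (low - how))) - qx * (qy * (qw * ((low + how) * (lbw + hbw)))) + qx * ((qy * (lby + hby)) * (qw * (low + how)))) - (qx * (hbx * (qy * qw * ((loy - low) * ((lby - hby) - (lbw - hbw)))) - lbx * (qy * qw * ((hoy - how) * ((lby - hby) - (lbw - hbw))))))) + (2 * (qx * (qw * (qy * ((loy - hoy) * (lby - hby)))) - qx * ((qw * (lbw - hbw)) * (qy * (loy - hoy))) - qx * (qw * (qy * ((loy + hoy) * (lby + hby)))) + qx * ((qw * (lbw + hbw)) * (qy * (loy + hoy)))) - (qx * (hbx * (qw * qy * ((low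 - loy) * ((lbw - hbw) - (lby - hby)))) - lbx * (qw * qy * ((how - hoy) * ((lbw - hbw) - (lby - hby))))))) + (2 * (qy * (qx * (qw * ((low - how) * (lbw - hbw)))) - qy * ((qx * (lbx - hbx)) * (qw * (low - how))) - qy * (qx * (qw * ((low + how) * (lbw + hbw)))) + qy * ((qx * (lbx + hbx)) * (qw * (low + how)))) - (qy * (hby * (qx * qw * ((lox - low) * ((lbx - hbx) - (lbw - hbw)))) - lby * (qx * qw * ((hox - how) * ((lbx - hbx) - (lbw - hbw))))))) + (2 * (qy * (qw * (qx * ((lox - hox) * (lbx - hbx)))) - qy * ((qw * (lbw - hbw)) * (qx * (lox - hox))) - qy * (qw * (qx * ((lox + hox) * (lbx + hbx)))) + qy * ((qw * (lbw + hbw)) * (qx * (lox + hox)))) - (qy * (hby * (qw * qx * ((low - lox) * ((lbw - hbw) - (lbx - hbx)))) - lby * (qw * qx * ((how - hox) * ((lbw - hbw) - (lbx - hbx))))))) + (2 * (qw * (qx * (qy * ((loy - hoy) * (lby - hby)))) - qw * ((qx * (lbx - hbx)) * (qy * (loy - hoy))) - qw * (qx * (qy * ((loy + hoy) * (lby + hby))))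 + qw * ((qx * (lbx + hbx)) * (qy * (loy + hoy)))) - (qw * (hbw * (qx * qy * ((lox - loy) * ((lbx - hbx) - (lby - hby)))) - lbw * (qx * qy * ((hox - hoy) * ((lbx - hbx) - (lby - hby))))))) + (2 * (qw * (qy * (qx * ((lox - hox) * (lbx - hbx)))) - qw * ((qy * (lby - hby)) * (qx * (lox - hox))) - qw * (qy * (qx * ((lox + hox) * (lbx + hbx)))) + qw * ((qy * (lby + hby)) * (qx * (lox + hox)))) - (qw * (hbw * (qy * qx * ((loy - lox) * ((lby - hby) - (lbx - hbx)))) - lbw * (qy * qx * ((hoy - hox) * ((lby - hby) - (lbx - hbx))))))) =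
      (qx * ((1 - lbx - hbx) + 2 * lbx) * (qy * qw * ((loy - low) * (hbw - hby))) + qx * ((qy * (1 - lby)) * (qw * (1 - lbw)) * ((loy - low) * (hbw - hby))) + qx * ((1 - lbx - hbx) + 2 * hbx) * (qy * qw * ((hoy - how) * (lbw - lby))) + qx * ((qy * (1 - hby)) * (qw * (1 - hbw)) * ((hoy - how) * (lbw - lby)))) + (qx * ((1 - lbx - hbx) + 2 * lbx) * (qw * qy * ((low - loy) * (hby - hbw))) + qx * ((qw * (1 - lbw)) * (qy * (1 - lby)) * ((low - loy) * (hby - hbw))) + qx * ((1 - lbx - hbx) + 2 * hbx) * (qw * qy * ((how - hoy) * (lby - lbw))) + qx * ((qw * (1 - hbw)) * (qy * (1 - hby)) * ((how - hoy) * (lby - lbw)))) + (qy * ((1 - lby - hby) + 2 * lby) * (qx * qw * ((lox - low) * (hbw - hbx))) + qy * ((qx * (1 - lbx)) * (qw * (1 - lbw)) * ((lox - low) * (hbw - hbx))) + qy * ((1 - lby - hby) + 2 * hby) * (qx * qw * ((hox - how) * (lbw - lbx))) + qy * ((qx * (1 - hbx)) * (qw * (1 - hbw)) * ((hox - how) *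 (lbw - lbx)))) + (qy * ((1 - lby - hby) + 2 * lby) * (qw * qx * ((low - lox) * (hbx - hbw))) + qy * ((qw * (1 - lbw)) * (qx * (1 - lbx)) * ((low - lox) * (hbx - hbw))) + qy * ((1 - lby - hby) + 2 * hby) * (qw * qx * ((how - hox) * (lbx - lbw))) + qy * ((qw * (1 - hbw)) * (qx * (1 - hbx)) * ((how - hox) * (lbx - lbw)))) + (qw * ((1 - lbw - hbw) + 2 * lbw) * (qx * qy * ((lox - loy) * (hby - hbx))) + qw * ((qx * (1 - lbx)) * (qy * (1 - lby)) * ((lox - loy) * (hby - hbx))) + qw * ((1 - lbw - hbw) + 2 * hbw) * (qx * qy * ((hox - hoy) * (lby - lbx))) + qw * ((qx * (1 - hbx)) * (qy * (1 - hby)) * ((hox - hoy) * (lby - lbx)))) + (qw * ((1 - lbw - hbw) + 2 * lbw) * (qy * qx * ((loy - lox) * (hbx - hby))) + qw * ((qy * (1 - lby)) * (qx * (1 - lbx)) * ((loy - lox) * (hbx - hby))) + qw * ((1 - lbw - hbw) + 2 * hbw) * (qy * qx * ((hoy - hox) * (lbx - lby))) + qw * ((qy * (1 - hby)) * (qx *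 (1 - hbx)) * ((hoy - hox) * (lbx - lby)))) := by
  linear_combination ((2) * lox * qy * lby * qw + (-4) * lox * qy * qw + (2) * lox * qy * qw * lbw + (2) * hox * qy * hby * qw + (-4) * hox * qy * qw + (2) * hox * qy * qw * hbw + (-2) * qy * loy * lby * qw + (2) * qy * loy * qw + (-2) * qy * hoy * hby * qw + (2) * qy * hoy * qw + (2) * qy * qw * low + (-2) * qy * qw * low * lbw + (2) * qy * qw * how + (-2) * qy * qw * how * hbw) * hx + ((-2) * qx * lox * lbx * qw + (2) * qx * lox * qw + (-2) * qx * hox * hbx * qw + (2) * qx * hox * qw + (2) * qx * lbx * loy * qw + (2) * qx * hbx * hoy * qw + (-4) * qx * loy * qw + (2) * qx * loy * qw * lbw + (-4) * qx * hoy * qw + (2) * qx * hoy * qw * hbw + (2) * qx * qw * low + (-2) * qx * qw * low * lbw + (2) * qx * qw * how + (-2) * qx * qw * how * hbw) * hy + ((-2) * qx * lox * lbx * qy + (2) * qx * lox * qy + (-2) * qx * hox * hbx * qy + (2) * qx * hox * qy + (2) * qx * lbx * qy * low + (2) * qx * hbx * qy * how + (2) * qx * qy * loy + (-2) * qx * qy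 * loy * lby + (2) * qx * qy * hoy + (-2) * qx * qy * hoy * hby + (2) * qx * qy * lby * low + (2) * qx * qy * hby * how + (-4) * qx * qy * low + (-4) * qx * qy * how) * hw

end Poly

/-! ## Pointwise facts on configurations -/

section Pointwise

variable {V : Type*} {E : Type*} {R : Type*} [Field R]
variable (ends : E → Sym2 V) (o a₁ a₂ a₃ b : V)

/-- Under `Q` a vertex lies in at most one root cluster: `1_Q · 1_{v∈C₁} · 1_{v∈C₂} = 0`. -/
lemma iQ_mul_iL_mul_iH (v : V) (ω : Config E) :
    iQ ends a₁ a₂ ω * (iL ends a₁ v ω * iH ends a₂ v ω) = (0 : R) := by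
  unfold iQ iL iH
  by_cases hq : ω ∈ avoidAll ends a₂ {a₁}
  · by_cases h1 : ω ∈ connEvent ends a₁ v
    · by_cases h2 : ω ∈ connEvent ends a₂ v
      · exfalso
        have hq' : ¬ Conn ends ω a₂ a₁ := by simpa [mem_avoidAll] using hq
        exact hq' (conn_trans h2 (conn_symm h1))
      · rw [Set.indicator_of_notMem h2]
        ring
    · rw [Set.indicator_of_notMem h1]
      ring
  · rw [Set.indicator_of_notMem hq]
    ring

/-- With the leaf edge closed, `1_{a₃∈C₁} = 0`. -/
lemma iL_a3_eq_zero_of_closed {f : E} (hf : ends f = s(a₃, b)) (hleaf : ∀ e, a₃ ∈ ends e → e = f)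
    (h3b : a₃ ≠ b) (h31 : a₃ ≠ a₁) {ω : Config E} (hω : ω f = false) :
    iL ends a₁ a₃ ω = (0 : R) := by
  have h : ω ∉ connEvent ends a₁ a₃ := fun hc =>
    not_conn_to_leaf ends a₃ b hf hleaf h3b hω h31.symm hc
  unfold iL
  rw [Set.indicator_of_notMem h]

/-- With the leaf edge closed, `1_{a₃∈C₂} = 0`. -/
lemma iH_a3_eq_zero_of_closed {f : E} (hf : ends f = s(a₃, b)) (hleaf : ∀ e, a₃ ∈ ends e → e = f)
    (h3b : a₃ ≠ b) (h32 : a₃ ≠ a₂) {ω : Config E} (hω : ω f = false) :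
    iH ends a₂ a₃ ω = (0 : R) := by
  have h : ω ∉ connEvent ends a₂ a₃ := fun hc =>
    not_conn_to_leaf ends a₃ b hf hleaf h3b hω h32.symm hc
  unfold iH
  rw [Set.indicator_of_notMem h]

/-- With the leaf edge closed, `1_PD = 1_Q`. -/
lemma iPD_eq_iQ_of_closed {f : E} (hf : ends f = s(a₃, b)) (hleaf : ∀ e, a₃ ∈ ends e → e = f)
    (h3b : a₃ ≠ b) (h31 : a₃ ≠ a₁) (h32 : a₃ ≠ a₂) {ω : Config E} (hω : ω f = false) :
    iPD ends a₁ a₂ a₃ ω = (iQ ends a₁ a₂ ω : R) := by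
  have h := mem_PDEvent_iff_of_closed ends a₁ a₂ a₃ b hf hleaf h3b h31 h32 hω
  unfold iPD iQ
  by_cases hp : ω ∈ PDEvent ends a₁ a₂ a₃
  · rw [Set.indicator_of_mem hp, Set.indicator_of_mem (h.1 hp)]
  · rw [Set.indicator_of_notMem hp, Set.indicator_of_notMem (fun hq => hp (h.2 hq))]

/-- **`K₃` on three configurations with the leaf edge closed is the isolated-`a₃` kernel.** -/
lemma K3_eq_inactive_of_closed {f : E} (hf : ends f = s(a₃, b)) (hleaf : ∀ e, a₃ ∈ ends e → e = f)
    (h3b : a₃ ≠ b) (h31 : a₃ ≠ a₁) (h32 : a₃ ≠ a₂) {x y w : Config E} (hx : x f = false)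
    (hy : y f = false) (hw : w f = false) :
    (K3 ends o a₁ a₂ a₃ b x y w : R) = (iQ ends a₁ a₂ x * (iQ ends a₁ a₂ y * (iQ ends a₁ a₂ w * ((iL ends a₁ o w - iH ends a₂ o w) * (iL ends a₁ b w - iH ends a₂ b w)))) - iQ ends a₁ a₂ x * ((iQ ends a₁ a₂ y * (iL ends a₁ b y - iH ends a₂ b y)) * (iQ ends a₁ a₂ w * (iL ends a₁ o w - iH ends a₂ o w))) - iQ ends a₁ a₂ x * (iQ ends a₁ a₂ y * (iQ ends a₁ a₂ w * ((iL ends a₁ o w + iH ends a₂ o w) * (iL ends a₁ b w + iH ends a₂ b w)))) + iQ ends a₁ a₂ x * ((iQ ends a₁ a₂ y * (iL ends a₁ b y + iH ends a₂ b y)) * (iQ ends a₁ a₂ w * (iL ends a₁ o w + iH ends a₂ o w)))) := by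
  unfold K3 sepKernel
  simp only [Fin.sum_univ_succ, Fin.sum_univ_zero, Matrix.cons_val_zero, Matrix.cons_val_succ,
    add_zero]
  unfold f3 f4 f5 f6 f7 f10 f11 f12 sigma inU
  rw [iPD_eq_iQ_of_closed ends a₁ a₂ a₃ b hf hleaf h3b h31 h32 hx,
    iPD_eq_iQ_of_closed ends a₁ a₂ a₃ b hf hleaf h3b h31 h32 hy,
    iPD_eq_iQ_of_closed ends a₁ a₂ a₃ b hf hleaf h3b h31 h32 hw,
    iL_a3_eq_zero_of_closed ends a₁ a₃ b hf hleaf h3b h31 hw,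
    iH_a3_eq_zero_of_closed ends a₂ a₃ b hf hleaf h3b h32 hw]
  ring

end Pointwise

/-! ## Typed-count bookkeeping -/

section Counts

variable {E : Type*} [Fintype E] [DecidableEq E] {R : Type*} [Field R]

/-- The typed count only sees the kernel on admissible triples. -/
lemma typedCount_congr_adm (F : Finset E) (z : Config E) (τ : E → ℕ)
    (K K' : Config E → Config E → Config E → R)
    (h : ∀ x y w : Config E, (∀ e, e ∉ F → x e = z e) → (∀ e, e ∉ F → y e = z e) →
      (∀ e, e ∉ F → w e = z e) → K x y w = K' x y w) :
    typedCount F z τ K = typedCount F z τ K' := by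
  unfold typedCount
  refine Finset.sum_congr rfl fun x _ => Finset.sum_congr rfl fun y _ =>
    Finset.sum_congr rfl fun w _ => ?_
  split_ifs with hc
  · exact h x y w (fun e he => (hc.1 e he).1) (fun e he => (hc.1 e he).2.1)
      (fun e he => (hc.1 e he).2.2)
  · rfl

/-- The typed count of a difference of kernels. -/
lemma typedCount_sub_loc (F : Finset E) (z : Config E) (τ : E → ℕ)
    (K K' : Config E → Config E → Config E → R) :
    typedCount F z τ (fun x y w => K x y w - K' x y w) = typedCount F z τ K - typedCount F z τ K' := by
  unfold typedCount
  simp only [← Finset.sum_sub_distrib]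
  refine Finset.sum_congr rfl fun x _ => Finset.sum_congr rfl fun y _ =>
    Finset.sum_congr rfl fun w _ => ?_
  split_ifs <;> simp

/-- The typed count of a scalar multiple. -/
lemma typedCount_const_mul_loc (F : Finset E) (z : Config E) (τ : E → ℕ) (c : R)
    (K : Config E → Config E → Config E → R) :
    typedCount F z τ (fun x y w => c * K x y w) = c * typedCount F z τ K := by
  unfold typedCount
  simp only [Finset.mul_sum]
  refine Finset.sum_congr rfl fun x _ => Finset.sum_congr rfl fun y _ =>
    Finset.sum_congr rfl fun w _ => ?_
  split_ifs <;> simp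

/-- A spectator-weighted two-copy count is nonnegative when the weight is nonnegative and the
pair kernel has nonnegative pinned counts on every minor. -/
lemma typedCount_spec_mul_nonneg [LinearOrder R] [IsStrictOrderedRing R] (F : Finset E)
    (z : Config E) (τ : E → ℕ) (hτ : ∀ e ∈ F, τ e = 1 ∨ τ e = 2) (g : Config E → R)
    (hg : ∀ x, 0 ≤ g x) (K : Config E → Config E → R)
    (hK : ∀ (G : Finset E) (z : Config E), 0 ≤ pinnedCount G z K) :
    0 ≤ typedCount F z τ (fun x y w => g x * K y w) := by
  rw [TypedA3.typedCount_eq_sum_spec F z τ hτ]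
  refine Finset.sum_nonneg fun x _ => ?_
  split_ifs
  · rw [TypedA3.pinnedCount_congr _ _ _ (fun y w => g x * K y w) (fun y w => rfl),
      TypedA3.pinnedCount_const_mul]
    exact mul_nonneg (hg x) (hK _ _)
  · exact le_rfl

end Counts

/-! ## The sign of the row -/

section Main

open Classical

variable {V : Type*} {E : Type*} [Fintype E] [DecidableEq E] {R : Type*} [Field R]
  [LinearOrder R] [IsStrictOrderedRing R]
variable (ends : E → Sym2 V) (o a₁ a₂ a₃ b : V)

/-- **`X ≤ 2N₀`**: the sign of the `b`-row, under the two cross statements and the two cross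
statements with the avoidance of `b`. -/
theorem two_N0_sub_X_nonneg {f : E} (hf : ends f = s(a₃, b))
    (hleaf : ∀ e, a₃ ∈ ends e → e = f) (h3b : a₃ ≠ b) (h31 : a₃ ≠ a₁) (h32 : a₃ ≠ a₂)
    (F : Finset E) (hfF : f ∈ F) (z : Config E) (τ : E → ℕ)
    (hτ : ∀ e ∈ F, e ≠ f → τ e = 1 ∨ τ e = 2)
    (hc₁ : CrossCount R ends a₁ a₂ o b) (hc₂ : CrossCount R ends a₂ a₁ o b)
    (hca₁ : ∀ (G : Finset E) (z : Config E), (0 : R) ≤ pinnedCount G z (fun y w =>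
      (iQ ends a₁ a₂ y * (1 - iL ends a₁ b y)) * (iQ ends a₁ a₂ w * (1 - iL ends a₁ b w)) *
        ((iL ends a₁ o y - iL ends a₁ o w) * (iH ends a₂ b w - iH ends a₂ b y))))
    (hca₂ : ∀ (G : Finset E) (z : Config E), (0 : R) ≤ pinnedCount G z (fun y w =>
      (iQ ends a₁ a₂ y * (1 - iH ends a₂ b y)) * (iQ ends a₁ a₂ w * (1 - iH ends a₂ b w)) *
        ((iH ends a₂ o y - iH ends a₂ o w) * (iL ends a₁ b w - iL ends a₁ b y)))) :
    0 ≤ 2 * typedCount F z (Function.update τ f 0)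
          (K3 ends o a₁ a₂ a₃ b : Config E → Config E → Config E → R) -
        typedCount F z (Function.update τ f 0) (fun x y w =>
          iQ ends a₁ a₂ x * (iH ends a₂ b x *
            TypedA3.covKer ends a₁ a₂ (iL ends a₁ o) (sigma ends a₁ a₂ b) y w -
            iL ends a₁ b x *
              TypedA3.covKer ends a₁ a₂ (iH ends a₂ o) (sigma ends a₁ a₂ b) y w)) := by
  rw [typedCount_type_zero F f hfF _ _ (Function.update_self f 0 τ),
    typedCount_type_zero F f hfF _ _ (Function.update_self f 0 τ)]
  have hfF' : f ∉ F.erase f := Finset.notMem_erase f F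
  have hτ' : ∀ e ∈ F.erase f, Function.update τ f 0 e = 1 ∨ Function.update τ f 0 e = 2 := by
    intro e he
    rw [Function.update_of_ne (Finset.ne_of_mem_erase he)]
    exact hτ e (Finset.mem_of_mem_erase he) (Finset.ne_of_mem_erase he)
  -- admissible configurations have the leaf edge closed
  have hcl : ∀ x : Config E, (∀ e, e ∉ F.erase f → x e = Function.update z f false e) →
      x f = false := fun x hx => by rw [hx f hfF', Function.update_self]
  -- the inactive kernel and the X kernel in the five atoms
  set Kin : Config E → Config E → Config E → R := fun x y w => (iQ ends a₁ a₂ x * (iQ ends a₁ a₂ y * (iQ ends a₁ a₂ w * ((iL ends a₁ o w - iH ends a₂ o w) * (iL ends a₁ b w - iH ends a₂ b w)))) - iQ ends a₁ a₂ x * ((iQ ends a₁ a₂ y * (iL ends a₁ b y - iH ends a₂ b y)) * (iQ ends a₁ a₂ w * (iL ends a₁ o w - iH ends a₂ o w))) - iQ ends a₁ a₂ x * (iQ ends a₁ a₂ y * (iQ ends a₁ a₂ w * ((iL ends a₁ o w + iH ends a₂ o w) * (iL ends a₁ b w + iH ends a₂ b w)))) + iQ ends a₁ a₂ x * ((iQ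 ends a₁ a₂ y * (iL ends a₁ b y + iH ends a₂ b y)) * (iQ ends a₁ a₂ w * (iL ends a₁ o w + iH ends a₂ o w)))) with hKin
  set Xk : Config E → Config E → Config E → R := fun x y w => (iQ ends a₁ a₂ x * (iH ends a₂ b x * (iQ ends a₁ a₂ y * iQ ends a₁ a₂ w * ((iL ends a₁ o y - iL ends a₁ o w) * ((iL ends a₁ b y - iH ends a₂ b y) - (iL ends a₁ b w - iH ends a₂ b w)))) - iL ends a₁ b x * (iQ ends a₁ a₂ y * iQ ends a₁ a₂ w * ((iH ends a₂ o y - iH ends a₂ o w) * ((iL ends a₁ b y - iH ends a₂ b y) - (iL ends a₁ b w - iH ends a₂ b w)))))) with hXk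
  set K1 : Config E → Config E → Config E → R := fun x y w => iQ ends a₁ a₂ x * ((1 - iL ends a₁ b x - iH ends a₂ b x) + 2 * iL ends a₁ b x) * (iQ ends a₁ a₂ y * iQ ends a₁ a₂ w * ((iL ends a₁ o y - iL ends a₁ o w) * (iH ends a₂ b w - iH ends a₂ b y))) with hK1
  set K2 : Config E → Config E → Config E → R := fun x y w => iQ ends a₁ a₂ x * ((iQ ends a₁ a₂ y * (1 - iL ends a₁ b y)) * (iQ ends a₁ a₂ w * (1 - iL ends a₁ b w)) * ((iL ends a₁ o y - iL ends a₁ o w) * (iH ends a₂ b w - iH ends a₂ b y))) with hK2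
  set K3' : Config E → Config E → Config E → R := fun x y w => iQ ends a₁ a₂ x * ((1 - iL ends a₁ b x - iH ends a₂ b x) + 2 * iH ends a₂ b x) * (iQ ends a₁ a₂ y * iQ ends a₁ a₂ w * ((iH ends a₂ o y - iH ends a₂ o w) * (iL ends a₁ b w - iL ends a₁ b y))) with hK3'
  set K4 : Config E → Config E → Config E → R := fun x y w => iQ ends a₁ a₂ x * ((iQ ends a₁ a₂ y * (1 - iH ends a₂ b y)) * (iQ ends a₁ a₂ w * (1 - iH ends a₂ b w)) * ((iH ends a₂ o y - iH ends a₂ o w) * (iL ends a₁ b w - iL ends a₁ b y))) with hK4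
  set Rk : Config E → Config E → Config E → R :=
    fun x y w => K1 x y w + K2 x y w + K3' x y w + K4 x y w with hRk
  have e1 : typedCount (F.erase f) (Function.update z f false) (Function.update τ f 0)
      (K3 ends o a₁ a₂ a₃ b : Config E → Config E → Config E → R) =
      typedCount (F.erase f) (Function.update z f false) (Function.update τ f 0) Kin :=
    typedCount_congr_adm _ _ _ _ _ fun x y w hx hy hw =>
      K3_eq_inactive_of_closed ends o a₁ a₂ a₃ b hf hleaf h3b h31 h32 (hcl x hx) (hcl y hy)
        (hcl w hw)
  have e2 : typedCount (F.erase f) (Function.update z f false) (Function.update τ f 0)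
      (fun x y w => iQ ends a₁ a₂ x * (iH ends a₂ b x *
        TypedA3.covKer ends a₁ a₂ (iL ends a₁ o) (sigma ends a₁ a₂ b) y w -
        iL ends a₁ b x * TypedA3.covKer ends a₁ a₂ (iH ends a₂ o) (sigma ends a₁ a₂ b) y w)) =
      typedCount (F.erase f) (Function.update z f false) (Function.update τ f 0) Xk :=
    typedCount_congr_adm _ _ _ _ _ fun x y w _ _ _ => by
      simp only [hXk, TypedA3.covKer, sigma]
  rw [e1, e2, ← typedCount_const_mul_loc, ← typedCount_sub_loc]
  -- symmetrise: 6·tc(2·Kin − Xk) = tc(sym) = tc(sym Rk) = 6·tc(Rk)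
  have hsym : typedCount (F.erase f) (Function.update z f false) (Function.update τ f 0)
      (fun x y w => 2 * Kin x y w - Xk x y w) =
      typedCount (F.erase f) (Function.update z f false) (Function.update τ f 0) Rk := by
    have h6 : (6 : R) ≠ 0 := by norm_num
    refine mul_left_cancel₀ h6 ?_
    rw [← typedCount_sym6, ← typedCount_sym6]
    refine typedCount_congr_adm _ _ _ _ _ fun x y w _ _ _ => ?_
    simp only [hKin, hXk, hRk, hK1, hK2, hK3', hK4]
    exact brow_sym_identity (iQ ends a₁ a₂ x) (iL ends a₁ o x) (iH ends a₂ o x) (iL ends a₁ b x)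
      (iH ends a₂ b x) (iQ ends a₁ a₂ y) (iL ends a₁ o y) (iH ends a₂ o y) (iL ends a₁ b y)
      (iH ends a₂ b y) (iQ ends a₁ a₂ w) (iL ends a₁ o w) (iH ends a₂ o w) (iL ends a₁ b w)
      (iH ends a₂ b w) (iQ_mul_iL_mul_iH ends a₁ a₂ b x) (iQ_mul_iL_mul_iH ends a₁ a₂ b y)
      (iQ_mul_iL_mul_iH ends a₁ a₂ b w)
  rw [hsym]
  -- the four pieces
  have hQn : ∀ x : Config E, (0 : R) ≤ iQ ends a₁ a₂ x := fun x => TypedA3.iQ_nonneg ends a₁ a₂ x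
  have hQn : ∀ x : Config E, (0 : R) ≤ iQ ends a₁ a₂ x := fun x => TypedA3.iQ_nonneg ends a₁ a₂ x
  have hb1 : ∀ x : Config E, (iH ends a₂ b x : R) ≤ 1 := fun x => by
    unfold iH
    exact Set.indicator_apply_le' (fun _ => le_rfl) (fun _ => zero_le_one)
  have hl1 : ∀ x : Config E, (iL ends a₁ b x : R) ≤ 1 := fun x => by
    unfold iL
    exact Set.indicator_apply_le' (fun _ => le_rfl) (fun _ => zero_le_one)
  have hb0 : ∀ x : Config E, (0 : R) ≤ iH ends a₂ b x := fun x => by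
    unfold iH
    exact Set.indicator_apply_nonneg fun _ => zero_le_one
  have hl0 : ∀ x : Config E, (0 : R) ≤ iL ends a₁ b x := fun x => by
    unfold iL
    exact Set.indicator_apply_nonneg fun _ => zero_le_one
  have hw1 : ∀ x : Config E, (0 : R) ≤ iQ ends a₁ a₂ x *
      ((1 - iL ends a₁ b x - iH ends a₂ b x) + 2 * iL ends a₁ b x) := fun x =>
    mul_nonneg (hQn x) (by linarith [hb1 x, hl0 x])
  have hw2 : ∀ x : Config E, (0 : R) ≤ iQ ends a₁ a₂ x *
      ((1 - iL ends a₁ b x - iH ends a₂ b x) + 2 * iH ends a₂ b x) := fun x =>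
    mul_nonneg (hQn x) (by linarith [hl1 x, hb0 x])
  -- the plain cross kernels are p1's cross kernels
  have hk1 : ∀ y w : Config E, (iQ ends a₁ a₂ y * iQ ends a₁ a₂ w *
      ((iL ends a₁ o y - iL ends a₁ o w) * (iH ends a₂ b w - iH ends a₂ b y)) : R) =
      crossKernel ends a₁ a₂ o b y w := by
    intro y w
    unfold crossKernel iQ iL iH
    rw [SideBridge.compl_conn_eq_avoidAll]
    ring
  have hk2 : ∀ y w : Config E, (iQ ends a₁ a₂ y * iQ ends a₁ a₂ w *
      ((iH ends a₂ o y - iH ends a₂ o w) * (iL ends a₁ b w - iL ends a₁ b y)) : R) =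
      crossKernel ends a₂ a₁ o b y w := by
    intro y w
    unfold crossKernel iQ iL iH
    rw [SideBridge.compl_conn_eq_avoidAll, SideBound.avoidAll_singleton_comm]
    ring
  have hc1' : ∀ (G : Finset E) (z : Config E), (0 : R) ≤ pinnedCount G z (fun y w =>
      iQ ends a₁ a₂ y * iQ ends a₁ a₂ w *
        ((iL ends a₁ o y - iL ends a₁ o w) * (iH ends a₂ b w - iH ends a₂ b y))) := by
    intro G z
    rw [TypedA3.pinnedCount_congr _ _ _ (crossKernel ends a₁ a₂ o b) hk1]
    exact hc₁ G z
  have hc2' : ∀ (G : Finset E) (z : Config E), (0 : R) ≤ pinnedCount G z (fun y w =>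
      iQ ends a₁ a₂ y * iQ ends a₁ a₂ w *
        ((iH ends a₂ o y - iH ends a₂ o w) * (iL ends a₁ b w - iL ends a₁ b y))) := by
    intro G z
    rw [TypedA3.pinnedCount_congr _ _ _ (crossKernel ends a₂ a₁ o b) hk2]
    exact hc₂ G z
  have hsplit : typedCount (F.erase f) (Function.update z f false) (Function.update τ f 0) Rk =
      typedCount (F.erase f) (Function.update z f false) (Function.update τ f 0) K1 +
      typedCount (F.erase f) (Function.update z f false) (Function.update τ f 0) K2 +
      typedCount (F.erase f) (Function.update z f false) (Function.update τ f 0) K3' +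
      typedCount (F.erase f) (Function.update z f false) (Function.update τ f 0) K4 := by
    rw [← typedCount_add, ← typedCount_add, ← typedCount_add]
  rw [hsplit]
  refine add_nonneg (add_nonneg (add_nonneg ?_ ?_) ?_) ?_
  · exact typedCount_spec_mul_nonneg _ _ _ hτ' _ hw1 _ hc1'
  · exact typedCount_spec_mul_nonneg _ _ _ hτ' _ hQn _ hca₁
  · exact typedCount_spec_mul_nonneg _ _ _ hτ' _ hw2 _ hc2'
  · exact typedCount_spec_mul_nonneg _ _ _ hτ' _ hQn _ hca₂

/-- **The sign of the `b`-row**: `N₀ ≤ N₁` and `N₃ ≤ N₂` (night-3's (PM) and (T23) at the leaf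
edge) under the four two-copy cross statements. -/
theorem typedCount_pendant_a3_at_b_ge {f : E} (hf : ends f = s(a₃, b))
    (hleaf : ∀ e, a₃ ∈ ends e → e = f) (h3b : a₃ ≠ b) (h3o : a₃ ≠ o) (h31 : a₃ ≠ a₁)
    (h32 : a₃ ≠ a₂) (F : Finset E) (hfF : f ∈ F) (z : Config E) (τ : E → ℕ)
    (hτ : ∀ e ∈ F, e ≠ f → τ e = 1 ∨ τ e = 2)
    (hc₁ : CrossCount R ends a₁ a₂ o b) (hc₂ : CrossCount R ends a₂ a₁ o b)
    (hca₁ : ∀ (G : Finset E) (z : Config E), (0 : R) ≤ pinnedCount G z (fun y w =>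
      (iQ ends a₁ a₂ y * (1 - iL ends a₁ b y)) * (iQ ends a₁ a₂ w * (1 - iL ends a₁ b w)) *
        ((iL ends a₁ o y - iL ends a₁ o w) * (iH ends a₂ b w - iH ends a₂ b y))))
    (hca₂ : ∀ (G : Finset E) (z : Config E), (0 : R) ≤ pinnedCount G z (fun y w =>
      (iQ ends a₁ a₂ y * (1 - iH ends a₂ b y)) * (iQ ends a₁ a₂ w * (1 - iH ends a₂ b w)) *
        ((iH ends a₂ o y - iH ends a₂ o w) * (iL ends a₁ b w - iL ends a₁ b y)))) :
    typedCount F z (Function.update τ f 0)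
        (K3 ends o a₁ a₂ a₃ b : Config E → Config E → Config E → R) ≤
      typedCount F z (Function.update τ f 1) (K3 ends o a₁ a₂ a₃ b) ∧
    typedCount F z (Function.update τ f 3)
        (K3 ends o a₁ a₂ a₃ b : Config E → Config E → Config E → R) ≤
      typedCount F z (Function.update τ f 2) (K3 ends o a₁ a₂ a₃ b) := by
  have h := two_N0_sub_X_nonneg ends o a₁ a₂ a₃ b hf hleaf h3b h31 h32 F hfF z τ hτ hc₁ hc₂
    hca₁ hca₂
  rw [typedCount_pendant_a3_at_b_one ends o a₁ a₂ a₃ b hf hleaf h3b h3o h31 h32 F hfF z τ,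
    typedCount_pendant_a3_at_b_two ends o a₁ a₂ a₃ b hf hleaf h3b h3o h31 h32 F hfF z τ]
  constructor <;> linarith

/-- **Row 2′TRI at a pendant `a₃` at `b`** reduces to the instance with the leaf removed and the
instance with `b = a₃` merged, modulo the four two-copy cross statements. -/
theorem typedCount_nonneg_pendant_a3_at_b {f : E} (hf : ends f = s(a₃, b))
    (hleaf : ∀ e, a₃ ∈ ends e → e = f) (h3b : a₃ ≠ b) (h3o : a₃ ≠ o) (h31 : a₃ ≠ a₁)
    (h32 : a₃ ≠ a₂) (F : Finset E) (hfF : f ∈ F) (z : Config E) (τ : E → ℕ)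
    (hτ : ∀ e ∈ F, e ≠ f → τ e = 1 ∨ τ e = 2)
    (hc₁ : CrossCount R ends a₁ a₂ o b) (hc₂ : CrossCount R ends a₂ a₁ o b)
    (hca₁ : ∀ (G : Finset E) (z : Config E), (0 : R) ≤ pinnedCount G z (fun y w =>
      (iQ ends a₁ a₂ y * (1 - iL ends a₁ b y)) * (iQ ends a₁ a₂ w * (1 - iL ends a₁ b w)) *
        ((iL ends a₁ o y - iL ends a₁ o w) * (iH ends a₂ b w - iH ends a₂ b y))))
    (hca₂ : ∀ (G : Finset E) (z : Config E), (0 : R) ≤ pinnedCount G z (fun y w =>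
      (iQ ends a₁ a₂ y * (1 - iH ends a₂ b y)) * (iQ ends a₁ a₂ w * (1 - iH ends a₂ b w)) *
        ((iH ends a₂ o y - iH ends a₂ o w) * (iL ends a₁ b w - iL ends a₁ b y))))
    (h0 : 0 ≤ typedCount F z (Function.update τ f 0)
      (K3 ends o a₁ a₂ a₃ b : Config E → Config E → Config E → R))
    (h3 : 0 ≤ typedCount F z (Function.update τ f 3)
      (K3 ends o a₁ a₂ a₃ b : Config E → Config E → Config E → R))
    (k : ℕ) (hk : k ≤ 3) :
    0 ≤ typedCount F z (Function.update τ f k)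
      (K3 ends o a₁ a₂ a₃ b : Config E → Config E → Config E → R) := by
  have h := typedCount_pendant_a3_at_b_ge ends o a₁ a₂ a₃ b hf hleaf h3b h3o h31 h32 F hfF z τ hτ
    hc₁ hc₂ hca₁ hca₂
  interval_cases k
  · exact h0
  · exact h0.trans h.1
  · exact h3.trans h.2
  · exact h3

end Main

end TypedRed

end CovForm

end Summit.Ventures.PercRepro2
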